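import Summits.MatrixMultiplication.OmegaCensus.SmallFormats.MatMul22nRankGF3Ladder
import Summits.MatrixMultiplication.OmegaCensus.SmallFormats.MatMul225GF3FrameCapCertificate
import HarnessLib

/-!
# ω-census family (a): the `𝔽₃` small-format LADDER for `⟨2,2,n⟩`, `5 ≤ n ≤ 12`, as of 2026-08-29 08:30Z — `n = 5` now EXACT

Cell `pub-omega` (unit `pub-omega-tensor`, gen 37), topic `Summits/MatrixMultiplication/OmegaCensus` (sub-folder `SmallFormats`). Framing
(verbatim): lottery ticket; floor = certified bounds/negative ranges. HONEST FRAMING: bookkeeping only — tensor g36's ladder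
`tensorRank_matMulTensor_22n_gf3_ladder_5_12` with the `n = 5` window `[17, 18]` replaced by the exact value `18`
(`Enum723.tensorRank_225_gf3`, this generation: the Alekseev-frame plane cap + the `(5,17)` count certificate). No new mathematics; nothing on `ω`.
-/

namespace Summit.MatrixMultiplication.OmegaCensus.SmallFormats

open Literature.Computability.AlgebraicComplexity

/-- **The `𝔽₃` ladder for `⟨2,2,n⟩`, `5 ≤ n ≤ 12` (kernel, 2026-08-29 08:30Z).** Exact: `n = 5` (18), `n = 6` (21). Windows: `7` [24,25],
`8` [27,28], `9` [30,32], `10` [34,35], `11` [37,39], `12` [40,42]. -/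
theorem tensorRank_matMulTensor_22n_gf3_ladder_5_12' :
    tensorRank (matMulTensor (ZMod 3) 2 2 5) = 18 ∧
    tensorRank (matMulTensor (ZMod 3) 2 2 6) = 21 ∧
    tensorRank (matMulTensor (ZMod 3) 2 2 7) ∈ Set.Icc 24 25 ∧
    tensorRank (matMulTensor (ZMod 3) 2 2 8) ∈ Set.Icc 27 28 ∧
    tensorRank (matMulTensor (ZMod 3) 2 2 9) ∈ Set.Icc 30 32 ∧
    tensorRank (matMulTensor (ZMod 3) 2 2 10) ∈ Set.Icc 34 35 ∧
    tensorRank (matMulTensor (ZMod 3) 2 2 11) ∈ Set.Icc 37 39 ∧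
    tensorRank (matMulTensor (ZMod 3) 2 2 12) ∈ Set.Icc 40 42 := by
  obtain ⟨-, h6, h7, h8, h9, h10, h11, h12⟩ := tensorRank_matMulTensor_22n_gf3_ladder_5_12
  exact ⟨Enum723.tensorRank_225_gf3, h6, h7, h8, h9, h10, h11, h12⟩

/-- The two EXACT small `𝔽₃` values of the `⟨2,2,n⟩` family beyond print (`n ≤ 4` is exact over every field): `R_𝔽₃(⟨2,2,5⟩) = 18` and
`R_𝔽₃(⟨2,2,6⟩) = 21`, both `= ⌈7n/2⌉` (Hopcroft–Kerr's count). -/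
theorem tensorRank_matMulTensor_225_226_gf3 :
    tensorRank (matMulTensor (ZMod 3) 2 2 5) = 18 ∧ tensorRank (matMulTensor (ZMod 3) 2 2 6) = 21 :=
  ⟨Enum723.tensorRank_225_gf3, Enum723.tensorRank_226_gf3⟩

end Summit.MatrixMultiplication.OmegaCensus.SmallFormats
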